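import Mathlib
import Summits.CriticalPhenomena.CardyFormulaZ2.Theorems.CardyMagicRigidityPositiveConeDefs
import Summits.CriticalPhenomena.CardyFormulaZ2.Theorems.CardyMagicRigidityNestingRigidityLatticeRegularityZ2
import Summits.CriticalPhenomena.CardyFormulaZ2.Theorems.CardyMagicRigidityNestingRigidityBondDuality
import Literature.Probability.Percolation.ClusterOuterBoundary
import HarnessLib

/-!
# Type alternation along the nesting tree on bond-`ℤ²` (line `positive-cone-weight-doubling`)

Crux `Summit.CriticalPhenomena.CardyFormulaZ2.Theses.CardyMagicRigidity.NestingRigidity`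
(stmt-CriticalPhenomena-4835), line `positive-cone-weight-doubling`, step (3) of the registered stub
`stub_treeRigidity`, bond side: the companion of `typeAlternation_tEns`
(`…NestingRigidityTypeAlternationT`) for DKKMO's typed loop representation
`zEns.X δ ω = bondLoopConfig δ 0 ω` of a bond configuration `ω` of `ℤ²` at mesh `δ > 0`
(`typeAlternation_zEns`): if `u ∈ F i`, `v ∈ F j`, the winding interior of `u` is strictly inside
that of `v` and no loop of the configuration sits strictly between them, then `i ≠ j`.

Mechanism (combinatorial, on top of the tree's corner calculus of medial interface loops,
`InterfaceLoopClusters.lean`, `InterfaceLoopWindingSign.lean`, `ClusterOuterBoundary.lean`):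

* §1 `unbasedLoop_eq_of_mem_zip`, `wind_eq_of_unbasedLoop_ne` — two interface loops of `ω` through
  a common dart are rotations of each other (`IsInterfaceLoop.rotate_eq_of_corner`) and draw the same
  unbased loop; so across a corner cut crossed by one loop (jump relation `wind_sub_wind_cFace`),
  every OTHER loop has equal winding numbers at the vertex and at the face centre.
* §2 `not_parent_of_loopType_zero` — two nested type-`0` (clockwise) loops `u ⊊ v` of a lattice
  configuration always have a type-`1` loop strictly between them: the left vertex `a` of a dart of
  `u` is outside `u` but (§1) inside `v`, so its open cluster `C` is inside `v` and finite; the outer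
  boundary `μ` of `C` (`exists_isInterfaceLoop_around_openCluster`: type `1`, winding `1` on `C`, a
  dart with left vertex in `C`) contains `a` and (§1) the face of that dart of `u`, which is inside
  `u`, so `{W(u) ≠ 0} ⊊ {W(μ) ≠ 0}` (`interfaceLoop_interiors_nested_or_disjoint`); the face of the
  dart of `μ` over `C` is outside `μ` but (§1, `μ ≠ v` by the signs at `a`) inside `v`, so
  `{W(μ) ≠ 0} ⊊ {W(v) ≠ 0}`.
* §3 `not_parent_zEns_zero` — the same for members of `(zEns.X δ ω).F 0` (any mesh, rescaling);
  `not_parent_zEns_one` — the type-`1` case is its planar dual (`mem_bondLoopConfig_dualConfig_iff`: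
  duality = reversal + type swap + half-mesh shift, which preserves strict nesting of interiors);
  `typeAlternation_zEns` — assembly, after discarding the non-lattice pairs of `ω` (the loop
  representation only reads lattice edges, `mem_bondLoopConfig_inter_edgeSet_iff`).
-/

noncomputable section

open MeasureTheory Set Filter Metric
open scoped Real Topology BigOperators

namespace Summit.CriticalPhenomena.CardyFormulaZ2.Cruxes.NestingRigidity.PositiveConeWeightDoubling

open Literature.Probability.RandomPlanarGeometry Literature.Probability.Percolation
  Literature.Probability.LatticeModels
open Summit.CriticalPhenomena.CardyFormulaZ2.Cruxes.NestingRigidity.RingCloudTomography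
open Summit.CriticalPhenomena.CardyFormulaZ2.Cruxes.NestingRigidity.MarkovCascadeOneGeneration

section MeshOne

variable {ω : BondConfig (Site 2)} {γ γ' : List MedialVertex}

/-! ## §1 Loops through a common dart coincide; no two loops jump across the same corner cut -/

/-- **Two interface loops of one configuration through a common dart draw the same unbased loop**
(at every mesh): they are rotations of each other (`IsInterfaceLoop.rotate_eq_of_corner`). -/
theorem unbasedLoop_eq_of_mem_zip (h : IsInterfaceLoop ω γ) (h' : IsInterfaceLoop ω γ')
    {p : Site 2 × Fin 4} (hp : (cSrc p, cTgt p) ∈ γ.zip (γ.rotate 1))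
    (hp' : (cSrc p, cTgt p) ∈ γ'.zip (γ'.rotate 1)) (δ : ℝ) :
    UnbasedLoop.mk (BasedLoop.mk (loopCurve δ 0 γ) (isLoop_loopCurve δ 0 h.ne_nil)) =
      UnbasedLoop.mk (BasedLoop.mk (loopCurve δ 0 γ') (isLoop_loopCurve δ 0 h'.ne_nil)) := by
  obtain ⟨i, hi, hie, hie'⟩ := exists_getElem_of_mem_zip_rotate hp
  obtain ⟨j, hj, hje, hje'⟩ := exists_getElem_of_mem_zip_rotate hp'
  have hps : cSrc p = γ[i % γ.length]'(Nat.mod_lt _ h.length_pos) :=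
    calc cSrc p = γ[i] := hie.symm
      _ = γ[i % γ.length]'(Nat.mod_lt _ h.length_pos) :=
        IsInterfaceLoop.getElem_idx_congr (Nat.mod_eq_of_lt hi).symm _
  have hps' : cSrc p = γ'[j % γ'.length]'(Nat.mod_lt _ h'.length_pos) :=
    calc cSrc p = γ'[j] := hje.symm
      _ = γ'[j % γ'.length]'(Nat.mod_lt _ h'.length_pos) :=
        IsInterfaceLoop.getElem_idx_congr (Nat.mod_eq_of_lt hj).symm _
  obtain rfl := h.rotate_eq_of_corner h' hi hj hps hie'.symm hps' hje'.symm
  exact (unbasedLoop_loopCurve_rotate δ 0 h.ne_nil _).symm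

/-- Interface loops drawing the same unbased loop (mesh `1`) wind equally about every point. -/
theorem wind_eq_of_unbasedLoop_eq (h : IsInterfaceLoop ω γ) (h' : IsInterfaceLoop ω γ')
    (he : UnbasedLoop.mk (BasedLoop.mk (loopCurve 1 0 γ) (isLoop_loopCurve 1 0 h.ne_nil)) =
      UnbasedLoop.mk (BasedLoop.mk (loopCurve 1 0 γ') (isLoop_loopCurve 1 0 h'.ne_nil))) (z : ℂ) :
    (loopCurve 1 0 γ).wind z = (loopCurve 1 0 γ').wind z := by
  have hz := congrArg (fun u : UnbasedLoop ℂ ↦ u.wind z) he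
  simpa only [wind_mk_mk] using hz

/-- **Across a corner cut crossed by one interface loop, every other interface loop of the
configuration winds equally about the vertex and about the face centre**: a jump of the winding
number across the cut of the corner `p` means that the dart of `p` is on the loop (jump relation
`wind_sub_wind_cFace`), and two loops of `ω` through a common dart coincide. -/
theorem wind_eq_of_unbasedLoop_ne (h : IsInterfaceLoop ω γ) (h' : IsInterfaceLoop ω γ')
    (hne : UnbasedLoop.mk (BasedLoop.mk (loopCurve 1 0 γ) (isLoop_loopCurve 1 0 h.ne_nil)) ≠
      UnbasedLoop.mk (BasedLoop.mk (loopCurve 1 0 γ') (isLoop_loopCurve 1 0 h'.ne_nil)))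
    {p : Site 2 × Fin 4}
    (hj : (loopCurve 1 0 γ).wind (meshPoint 1 p.1) ≠ (loopCurve 1 0 γ).wind (faceCenter (cFace p))) :
    (loopCurve 1 0 γ').wind (meshPoint 1 p.1) = (loopCurve 1 0 γ').wind (faceCenter (cFace p)) := by
  have hp : (cSrc p, cTgt p) ∈ γ.zip (γ.rotate 1) := by
    by_contra hn
    have h0 := h.wind_sub_wind_cFace p
    rw [if_neg hn] at h0
    exact hj (by omega)
  by_contra hj'
  have hp' : (cSrc p, cTgt p) ∈ γ'.zip (γ'.rotate 1) := by
    by_contra hn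
    have h0 := h'.wind_sub_wind_cFace p
    rw [if_neg hn] at h0
    exact hj' (by omega)
  exact hne (unbasedLoop_eq_of_mem_zip h h' hp hp' 1)

/-- **Only finitely many lattice points are enclosed by a medial loop** (the trace is bounded and
the winding number vanishes outside a ball containing it). -/
theorem finite_setOf_wind_meshPoint_ne_zero (γ : List MedialVertex) :
    {y : Site 2 | (loopCurve 1 0 γ).wind (meshPoint 1 y) ≠ 0}.Finite := by
  obtain ⟨ρ, hρ⟩ := (loopCurve 1 0 γ).isCompact_range.isBounded.subset_ball 0
  refine (meshVertices_finite (Ω := ball (0 : ℂ) ρ) isBounded_ball one_pos).subset fun y hy ↦ ?_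
  rw [mem_meshVertices_iff, mem_ball]
  by_contra hfar
  exact hy ((loopCurve 1 0 γ).wind_eq_zero_of_subset_ball hρ (not_lt.1 hfar))

/-! ## §2 Two nested type-`0` loops have a type-`1` loop strictly between them -/

/-- **Type-`0` case** (mesh `1`, lattice configuration `ω ⊆ E(ℤ²)`).  If `γ`, `γ'` are type-`0`
(clockwise) interface loops of `ω` with `{W(γ) ≠ 0} ⊊ {W(γ') ≠ 0}`, some interface loop `μ` of `ω`
has `{W(γ) ≠ 0} ⊊ {W(μ) ≠ 0} ⊊ {W(γ') ≠ 0}` — the outer boundary of the (finite) open cluster of the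
rim of `γ`; so `γ'` is not the parent of `γ`. -/
theorem not_parent_of_loopType_zero (hω : ω ⊆ (zdGraph 2).edgeSet) (hu : IsInterfaceLoop ω γ)
    (hv : IsInterfaceLoop ω γ') (htu : loopType γ = 0) (htv : loopType γ' = 0)
    (huv : {z | (loopCurve 1 0 γ).wind z ≠ 0} ⊂ {z | (loopCurve 1 0 γ').wind z ≠ 0})
    (hmin : ∀ μ : List MedialVertex, IsInterfaceLoop ω μ →
      ¬ ({z | (loopCurve 1 0 γ).wind z ≠ 0} ⊂ {z | (loopCurve 1 0 μ).wind z ≠ 0} ∧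
        {z | (loopCurve 1 0 μ).wind z ≠ 0} ⊂ {z | (loopCurve 1 0 γ').wind z ≠ 0})) : False := by
  -- the two loops differ
  have hne : UnbasedLoop.mk (BasedLoop.mk (loopCurve 1 0 γ) (isLoop_loopCurve 1 0 hu.ne_nil)) ≠
      UnbasedLoop.mk (BasedLoop.mk (loopCurve 1 0 γ') (isLoop_loopCurve 1 0 hv.ne_nil)) := fun he ↦
    huv.ne (by
      change {z | (UnbasedLoop.mk (BasedLoop.mk (loopCurve 1 0 γ) (isLoop_loopCurve 1 0 hu.ne_nil))).wind
        z ≠ 0} = {z | (UnbasedLoop.mk (BasedLoop.mk (loopCurve 1 0 γ')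
          (isLoop_loopCurve 1 0 hv.ne_nil))).wind z ≠ 0}
      rw [he])
  -- the first dart of `u`: its left vertex `a` is outside `u`, the centre of its face `f` inside
  obtain ⟨p, hps, hpt⟩ := hu.exists_corner 0
  have hp : (cSrc p, cTgt p) ∈ γ.zip (γ.rotate 1) := by
    rw [hps, hpt]; exact hu.getElem_mod_mem_zip 0
  have hua : (loopCurve 1 0 γ).wind (meshPoint 1 p.1) = 0 := hu.wind_left_eq_zero htu hp
  have huf : (loopCurve 1 0 γ).wind (faceCenter (cFace p)) = -1 := hu.wind_cFace_eq_neg_one htu hp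
  have hujump : (loopCurve 1 0 γ).wind (meshPoint 1 p.1) ≠
      (loopCurve 1 0 γ).wind (faceCenter (cFace p)) := by
    rw [hua, huf]; norm_num
  have hfU : faceCenter (cFace p) ∈ {z | (loopCurve 1 0 γ).wind z ≠ 0} := by
    show _ ≠ (0 : ℤ); rw [huf]; norm_num
  have haU : meshPoint 1 p.1 ∉ {z | (loopCurve 1 0 γ).wind z ≠ 0} := fun h ↦ h hua
  have hfV : faceCenter (cFace p) ∈ {z | (loopCurve 1 0 γ').wind z ≠ 0} := huv.1 hfU
  have hva : (loopCurve 1 0 γ').wind (meshPoint 1 p.1) ≠ 0 := by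
    rw [wind_eq_of_unbasedLoop_ne hu hv hne hujump]; exact hfV
  have haV : meshPoint 1 p.1 ∈ {z | (loopCurve 1 0 γ').wind z ≠ 0} := hva
  -- the open cluster `C` of `a` is inside `v`, hence finite
  have hCv : ∀ y ∈ openCluster ω p.1, (loopCurve 1 0 γ').wind (meshPoint 1 y) ≠ 0 := fun y hy ↦ by
    rw [← hv.wind_eq_of_mem_openCluster hω hy]; exact hva
  have hCfin : (openCluster ω p.1).Finite := (finite_setOf_wind_meshPoint_ne_zero γ').subset hCv
  -- its outer boundary `μ`: type `1`, winding `1` on `C`, a dart `q` with left vertex in `C`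
  obtain ⟨μ, hμ, htμ, ⟨q, hq, hqC⟩, hμC, -⟩ := exists_isInterfaceLoop_around_openCluster hω hCfin
  have hμa : (loopCurve 1 0 μ).wind (meshPoint 1 p.1) = 1 := hμC _ (mem_openCluster_self ω p.1)
  have haM : meshPoint 1 p.1 ∈ {z | (loopCurve 1 0 μ).wind z ≠ 0} := by
    show _ ≠ (0 : ℤ); rw [hμa]; exact one_ne_zero
  -- `μ ≠ u` (signs at `a`), so the face centre is inside `μ` too: `{W(u) ≠ 0} ⊊ {W(μ) ≠ 0}`
  have hneμu : UnbasedLoop.mk (BasedLoop.mk (loopCurve 1 0 γ) (isLoop_loopCurve 1 0 hu.ne_nil)) ≠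
      UnbasedLoop.mk (BasedLoop.mk (loopCurve 1 0 μ) (isLoop_loopCurve 1 0 hμ.ne_nil)) := fun he ↦ by
    have h0 := wind_eq_of_unbasedLoop_eq hu hμ he (meshPoint 1 p.1)
    rw [hua, hμa] at h0
    norm_num at h0
  have hfM : faceCenter (cFace p) ∈ {z | (loopCurve 1 0 μ).wind z ≠ 0} := by
    show _ ≠ (0 : ℤ)
    rw [← wind_eq_of_unbasedLoop_ne hu hμ hneμu hujump, hμa]; exact one_ne_zero
  have h1 : {z | (loopCurve 1 0 γ).wind z ≠ 0} ⊂ {z | (loopCurve 1 0 μ).wind z ≠ 0} := by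
    rcases interfaceLoop_interiors_nested_or_disjoint ω γ μ hu hμ with h | h | h
    · exact ⟨h, fun h' ↦ haU (h' haM)⟩
    · exact absurd (h haM) haU
    · exact absurd hfM (h.notMem_of_mem_left hfU)
  -- `μ ≠ v` (signs at `a`), so the face of the dart `q` of `μ` over `C` is inside `v`; it is
  -- outside `μ`: `{W(μ) ≠ 0} ⊊ {W(v) ≠ 0}`
  have hva' : (loopCurve 1 0 γ').wind (meshPoint 1 p.1) = -1 := by
    rcases hv.wind_mem_and_loopSignedArea with ⟨-, hpos⟩ | ⟨hw, -⟩
    · have h1' : loopType γ' = 1 := by rw [loopType, if_pos hpos]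
      rw [htv] at h1'
      exact absurd h1' (by decide)
    · exact (hw _).resolve_left hva
  have hneμv : UnbasedLoop.mk (BasedLoop.mk (loopCurve 1 0 μ) (isLoop_loopCurve 1 0 hμ.ne_nil)) ≠
      UnbasedLoop.mk (BasedLoop.mk (loopCurve 1 0 γ') (isLoop_loopCurve 1 0 hv.ne_nil)) := fun he ↦ by
    have h0 := wind_eq_of_unbasedLoop_eq hμ hv he (meshPoint 1 p.1)
    rw [hμa, hva'] at h0
    norm_num at h0
  have hμq : (loopCurve 1 0 μ).wind (meshPoint 1 q.1) = 1 := hμ.wind_left_eq_one htμ hq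
  have hμg : (loopCurve 1 0 μ).wind (faceCenter (cFace q)) = 0 := hμ.wind_cFace_eq_zero htμ hq
  have hvq : (loopCurve 1 0 γ').wind (meshPoint 1 q.1) ≠ 0 := hCv _ hqC
  have hvg : (loopCurve 1 0 γ').wind (faceCenter (cFace q)) ≠ 0 := by
    rw [← wind_eq_of_unbasedLoop_ne hμ hv hneμv (by rw [hμq, hμg]; exact one_ne_zero)]; exact hvq
  have hgV : faceCenter (cFace q) ∈ {z | (loopCurve 1 0 γ').wind z ≠ 0} := hvg
  have hgM : faceCenter (cFace q) ∉ {z | (loopCurve 1 0 μ).wind z ≠ 0} := fun h ↦ h hμg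
  have h2 : {z | (loopCurve 1 0 μ).wind z ≠ 0} ⊂ {z | (loopCurve 1 0 γ').wind z ≠ 0} := by
    rcases interfaceLoop_interiors_nested_or_disjoint ω μ γ' hμ hv with h | h | h
    · exact ⟨h, fun h' ↦ hgM (h' hgV)⟩
    · exact absurd (h hgV) hgM
    · exact absurd haV (h.notMem_of_mem_left haM)
  exact hmin μ hμ ⟨h1, h2⟩

end MeshOne

/-! ## §3 Members of `zEns.X δ ω`: rescaling, planar duality, lattice edges -/

/-- Strict inclusion is reflected and preserved by preimages under a surjection. -/
theorem preimage_ssubset_preimage_iff {α β : Type*} {f : α → β} (hf : Function.Surjective f)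
    {s t : Set β} : f ⁻¹' s ⊂ f ⁻¹' t ↔ s ⊂ t := by
  rw [ssubset_def, ssubset_def, hf.preimage_subset_preimage_iff, hf.preimage_subset_preimage_iff]

/-- **Type-`0` case for `zEns.X δ ω`** (`δ > 0`, lattice configuration): two members of `F 0` are
never parent and child in the nesting tree (rescaling of `not_parent_of_loopType_zero`). -/
theorem not_parent_zEns_zero {δ : ℝ} (hδ : 0 < δ) {ω : BondConfig (Site 2)}
    (hω : ω ⊆ (zdGraph 2).edgeSet) {u v : UnbasedLoop ℂ} (hu : u ∈ (zEns.X δ ω).F 0)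
    (hv : v ∈ (zEns.X δ ω).F 0) (huv : {z | u.wind z ≠ 0} ⊂ {z | v.wind z ≠ 0})
    (hmin : ∀ w ∈ (zEns.X δ ω).loops,
      ¬ ({z | u.wind z ≠ 0} ⊂ {z | w.wind z ≠ 0} ∧ {z | w.wind z ≠ 0} ⊂ {z | v.wind z ≠ 0})) :
    False := by
  obtain ⟨γ, hγ, ht, rfl⟩ := hu
  obtain ⟨γ', hγ', ht', rfl⟩ := hv
  have hs : Function.Surjective fun z : ℂ ↦ z / δ := fun w ↦
    ⟨δ * w, mul_div_cancel_left₀ w (Complex.ofReal_ne_zero.2 hδ.ne')⟩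
  simp only [wind_mk_mk, setOf_wind_loopCurve_mesh hδ.ne', preimage_ssubset_preimage_iff hs] at huv
  refine not_parent_of_loopType_zero hω hγ hγ' ht ht' huv fun μ hμ hh ↦ ?_
  have h0 := hmin _ (mem_loops_zEns_iff.2 ⟨μ, hμ, rfl⟩)
  simp only [wind_mk_mk, setOf_wind_loopCurve_mesh hδ.ne', preimage_ssubset_preimage_iff hs] at h0
  exact h0 hh

/-- The winding interior of a translated and reversed loop is the translated winding interior. -/
theorem setOf_wind_map_translate_reverse (x : UnbasedLoop ℂ) (c : ℂ) :
    {z | ((x.map ⟨fun w ↦ 1 * w + c, continuous_translate c⟩ (isometry_translate c)).reverse).wind z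
      ≠ 0} = (fun z ↦ z - c) ⁻¹' {z | x.wind z ≠ 0} := by
  ext z
  simp only [mem_setOf_eq, mem_preimage, UnbasedLoop.wind_reverse, neg_ne_zero]
  rw [← wind_map_translate x c (z - c), sub_add_cancel]

/-- **Type-`1` case for `zEns.X δ ω`**, the planar dual of `not_parent_zEns_zero`: the members of
`F 1` of `ω` are the members of `F 0` of `dualConfig ω` shifted by half a mesh diagonal and read
backwards (`mem_bondLoopConfig_dualConfig_iff`), an operation on ALL loops of the two
configurations which preserves strict nesting of winding interiors. -/
theorem not_parent_zEns_one {δ : ℝ} (hδ : 0 < δ) {ω : BondConfig (Site 2)}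
    (hω : ω ⊆ (zdGraph 2).edgeSet) {u v : UnbasedLoop ℂ} (hu : u ∈ (zEns.X δ ω).F 1)
    (hv : v ∈ (zEns.X δ ω).F 1) (huv : {z | u.wind z ≠ 0} ⊂ {z | v.wind z ≠ 0})
    (hmin : ∀ w ∈ (zEns.X δ ω).loops,
      ¬ ({z | u.wind z ≠ 0} ⊂ {z | w.wind z ≠ 0} ∧ {z | w.wind z ≠ 0} ⊂ {z | v.wind z ≠ 0})) :
    False := by
  -- the duality map `T` and its inverse `S`
  set c : ℂ := δ * (1 + Complex.I) / 2 with hc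
  let T : UnbasedLoop ℂ → UnbasedLoop ℂ := fun y ↦
    (y.map ⟨fun w ↦ 1 * w + c, continuous_translate c⟩ (isometry_translate c)).reverse
  let S : UnbasedLoop ℂ → UnbasedLoop ℂ := fun x ↦
    (x.map ⟨fun w ↦ 1 * w + -c, continuous_translate (-c)⟩ (isometry_translate (-c))).reverse
  have hTS : ∀ x, T (S x) = x := fun x ↦ by
    simp only [T, S]
    rw [← UnbasedLoop.reverse_map, UnbasedLoop.reverse_reverse]
    -- translating by `-c` and then by `c` is the identity (as `map_translate_map_translate_neg`)
    obtain ⟨ℓ, rfl⟩ := UnbasedLoop.mk_surjective x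
    rw [UnbasedLoop.map_mk, UnbasedLoop.map_mk, BasedLoop.map_map]
    have hid : (⟨fun w ↦ 1 * w + c, continuous_translate c⟩ : C(ℂ, ℂ)).comp
        ⟨fun w ↦ 1 * w + -c, continuous_translate (-c)⟩ = ContinuousMap.id ℂ := by
      ext w
      simp
    rw [hid, BasedLoop.map_id]
  have hdual := mem_bondLoopConfig_dualConfig_iff δ ω hω
  have hωd : dualConfig ω ⊆ (zdGraph 2).edgeSet := fun e he ↦ (mem_dualConfig_iff.1 he).1
  have hIT : ∀ y, {z | (T y).wind z ≠ 0} = (fun z ↦ z - c) ⁻¹' {z | y.wind z ≠ 0} := fun y ↦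
    setOf_wind_map_translate_reverse y c
  have hIS : ∀ x, {z | x.wind z ≠ 0} = (fun z ↦ z - c) ⁻¹' {z | (S x).wind z ≠ 0} := fun x ↦ by
    rw [← hIT, hTS]
  have hsurj : Function.Surjective fun z : ℂ ↦ z - c := fun w ↦ ⟨w + c, add_sub_cancel_right w c⟩
  -- `S u`, `S v` are members of `F 0` of the dual configuration
  have hSmem : ∀ {x}, x ∈ (zEns.X δ ω).F 1 → S x ∈ (zEns.X δ (dualConfig ω)).F 0 := fun {x} hx ↦
    (hdual 0 (S x)).2 (by rw [show (1 : Fin 2) - 0 = 1 from rfl]; change T (S x) ∈ _; rwa [hTS])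
  refine not_parent_zEns_zero hδ hωd (hSmem hu) (hSmem hv) ?_ fun w hw hh ↦ ?_
  · rwa [hIS u, hIS v, preimage_ssubset_preimage_iff hsurj] at huv
  · -- `T w` is a loop of `ω` strictly between `u` and `v`
    obtain ⟨i, hwi⟩ : ∃ i, w ∈ (zEns.X δ (dualConfig ω)).F i := by
      rcases LoopConfig.mem_loops_iff.1 hw with h | h
      · exact ⟨0, h⟩
      · exact ⟨1, h⟩
    have hTw : T w ∈ (zEns.X δ ω).loops := LoopConfig.subset_loops _ (1 - i) ((hdual i w).1 hwi)
    refine hmin (T w) hTw ?_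
    rw [hIS u, hIS v, hIT w, preimage_ssubset_preimage_iff hsurj, preimage_ssubset_preimage_iff hsurj]
    exact hh

/-- The interface loops of `ω` only read its lattice edges. -/
theorem isInterfaceLoop_inter_edgeSet_iff {ω : BondConfig (Site 2)} {γ : List MedialVertex} :
    IsInterfaceLoop (ω ∩ (zdGraph 2).edgeSet) γ ↔ IsInterfaceLoop ω γ := by
  constructor <;> intro h <;> refine isInterfaceLoop_of_forall_mem_iff (fun e he ↦ ?_) h
  · exact ⟨fun h' ↦ h'.1, fun h' ↦ ⟨h', mem_edgeSet_of_mem_interfaceLoop h he⟩⟩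
  · exact ⟨fun h' ↦ ⟨h', mem_edgeSet_of_mem_interfaceLoop h he⟩, fun h' ↦ h'.1⟩

/-- The typed loop representation of `ω` only reads its lattice edges. -/
theorem mem_bondLoopConfig_inter_edgeSet_iff {δ : ℝ} {ω : BondConfig (Site 2)} {i : Fin 2}
    {x : UnbasedLoop ℂ} :
    x ∈ (zEns.X δ (ω ∩ (zdGraph 2).edgeSet : BondConfig (Site 2))).F i ↔ x ∈ (zEns.X δ ω).F i := by
  constructor
  · rintro ⟨γ, h, ht, rfl⟩
    exact ⟨γ, isInterfaceLoop_inter_edgeSet_iff.1 h, ht, rfl⟩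
  · rintro ⟨γ, h, ht, rfl⟩
    exact ⟨γ, isInterfaceLoop_inter_edgeSet_iff.2 h, ht, rfl⟩

/-- **Type alternation along the nesting tree on bond-`ℤ²`.**  In the typed loop representation
`zEns.X δ ω = bondLoopConfig δ 0 ω` (`δ > 0`, ANY bond configuration `ω`): if `u ∈ F i`, `v ∈ F j`,
the winding interior of `u` is strictly inside that of `v`, and no loop of the configuration has
its winding interior strictly between the two (i.e. `v` is the parent of `u` in the nesting tree),
then `i ≠ j` — a loop and its parent have opposite DKKMO types (`not_parent_zEns_zero`,
`not_parent_zEns_one`). -/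
theorem typeAlternation_zEns : ∀ {δ : ℝ}, 0 < δ → ∀ (ω : BondConfig (Site 2)) {i j : Fin 2} {u v : UnbasedLoop ℂ}, u ∈ (zEns.X δ ω).F i → v ∈ (zEns.X δ ω).F j → {z | u.wind z ≠ 0} ⊂ {z | v.wind z ≠ 0} → (∀ w ∈ (zEns.X δ ω).loops, ¬ ({z | u.wind z ≠ 0} ⊂ {z | w.wind z ≠ 0} ∧ {z | w.wind z ≠ 0} ⊂ {z | v.wind z ≠ 0})) → i ≠ j := by
  rintro δ hδ ω i j u v hu hv huv hmin rfl
  -- discard the non-lattice pairs of `ω`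
  have hω' : ω ∩ (zdGraph 2).edgeSet ⊆ (zdGraph 2).edgeSet := inter_subset_right
  have hu' := mem_bondLoopConfig_inter_edgeSet_iff.2 hu
  have hv' := mem_bondLoopConfig_inter_edgeSet_iff.2 hv
  have hmin' : ∀ w ∈ (zEns.X δ (ω ∩ (zdGraph 2).edgeSet : BondConfig (Site 2))).loops,
      ¬ ({z | u.wind z ≠ 0} ⊂ {z | w.wind z ≠ 0} ∧ {z | w.wind z ≠ 0} ⊂ {z | v.wind z ≠ 0}) := by
    intro w hw
    refine hmin w ?_
    rcases LoopConfig.mem_loops_iff.1 hw with h | h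
    · exact LoopConfig.subset_loops _ 0 (mem_bondLoopConfig_inter_edgeSet_iff.1 h)
    · exact LoopConfig.subset_loops _ 1 (mem_bondLoopConfig_inter_edgeSet_iff.1 h)
  have h01 : i = 0 ∨ i = 1 := by
    rcases i with ⟨_ | _ | n, hn⟩
    · exact Or.inl rfl
    · exact Or.inr rfl
    · omega
  rcases h01 with rfl | rfl
  · exact not_parent_zEns_zero hδ hω' hu' hv' huv hmin'
  · exact not_parent_zEns_one hδ hω' hu' hv' huv hmin'

end Summit.CriticalPhenomena.CardyFormulaZ2.Cruxes.NestingRigidity.PositiveConeWeightDoubling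

end
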